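import Summits.CriticalPhenomena.SAWScalingLimit.Theses.SAWTotalPositivity

/-!
# Negative lemma for the crux `SAWTotalPositivity.TPToTraversalBound` (stmt-CriticalPhenomena-10687):
the sketch lemma `AnnulusPairingGap` (card `bad-slices-are-free`, ideator 3) is FALSE as typed

Refuter `cdisprove` (standing adversary, cycle 2; landed cycle 3); work file
`Summits/CriticalPhenomena/SAWScalingLimit/Cruxes/TPToTraversalBound/Disproof.lean` §7, negative note
`Cruxes/TPToTraversalBound/NegativeAnnulusPairingGap.md`.  The refuted `Prop` is a VERBATIM copy of
`Summit.CriticalPhenomena.SAWScalingLimit.Cruxes.TPToTraversalBound.Sketch.AnnulusPairingGap`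
(`Cruxes/TPToTraversalBound/Sketch.lean`, 2026-08-15; crux work files cannot be imported here) with its
auxiliaries `Z`, `annulusDomain`, `IsOuterPost`, `IsInnerPost`.

Statement refuted: `∃ C θ, 1 < C ∧ θ < 1 ∧ ∀ δ > 0, ∀ a₁ ≠ a₂ (outer posts), b₁ ≠ b₂ (inner posts) of the lattice
annulus of {1 < |z| < C} at mesh δ: Z(a₁,b₁)·Z(a₂,b₂) ≤ θ·(Z(a₁,a₂)·Z(b₁,b₂))`.

Witness (for EVERY `C > 1`, every `θ`): the coarse mesh `δ = max (C/√2) ((1+C)/2)` makes the lattice annulus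
the four pairwise non-adjacent sites `±e₁, ±e₂` (edgeless discrete domain, all components tied singletons), each
simultaneously an outer and an inner post; `a₁ = b₁ = e₁`, `a₂ = b₂ = -e₁` gives `1 ≤ θ · 0`.
Class: misstated (coarse-mesh junk + coincident posts).  Repair: `∃ C θ δ₀, … ∀ δ ∈ (0, δ₀]` (thick LATTICE
annulus, which also forces `{a₁,a₂} ∩ {b₁,b₂} = ∅`); the repaired statement is an open RSW-type inequality,
plausible, untouched by this witness.  Moral for crux-plan: every sketch lemma quantifying `∀ δ > 0` over a FIXED
continuum domain inherits the coarse-mesh degenerations of `meshDomain` (cf. the refuted all-δ `Tight`,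
stmt-CriticalPhenomena-0772); lemmas typed at mesh 1 on lattice-sized domains or along `δ = 1/(n+2)` are immune.
-/

namespace Summit.CriticalPhenomena.SAWScalingLimit.Theorems.TPToTraversalBound.Negative

open Summit.CriticalPhenomena.SAWScalingLimit.Theses.SAWTotalPositivity
open Literature.Probability.RandomPlanarGeometry Literature.Probability.LatticeModels MeasureTheory

section TargetsSection

open Literature.Probability.RandomPlanarGeometry.SAW Literature.Probability.Percolation Filter Topology Set


noncomputable section

/-- Verbatim copy of `Sketch.Z` (Cruxes/TPToTraversalBound/Sketch.lean, ideator 3). -/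
abbrev Z (Ω : Set ℂ) (δ : ℝ) (u v : Site 2) : ENNReal := SAW.weight Ω δ u v Set.univ

/-- Verbatim copy of `Sketch.annulusDomain`. -/
def annulusDomain (C : ℝ) : Set ℂ := {z : ℂ | 1 < ‖z‖ ∧ ‖z‖ < C}

/-- Verbatim copy of `Sketch.IsOuterPost`. -/
def IsOuterPost (C δ : ℝ) (u : Site 2) : Prop :=
  u ∈ meshDomain (annulusDomain C) δ ∧ ∃ v : Site 2, (zdGraph 2).Adj u v ∧ C ≤ ‖meshPoint δ v‖

/-- Verbatim copy of `Sketch.IsInnerPost`. -/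
def IsInnerPost (C δ : ℝ) (u : Site 2) : Prop :=
  u ∈ meshDomain (annulusDomain C) δ ∧ ∃ v : Site 2, (zdGraph 2).Adj u v ∧ ‖meshPoint δ v‖ ≤ 1

/-- Verbatim copy of `Sketch.AnnulusPairingGap` (card `bad-slices-are-free`, "the ONE-family
seed"), ideator 3, Cruxes/TPToTraversalBound/Sketch.lean as of 2026-08-15T23:38Z. -/
def AnnulusPairingGap : Prop :=
  ∃ C θ : ℝ, 1 < C ∧ θ < 1 ∧ ∀ δ : ℝ, 0 < δ →
    ∀ a₁ a₂ b₁ b₂ : Site 2, a₁ ≠ a₂ → b₁ ≠ b₂ →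
      IsOuterPost C δ a₁ → IsOuterPost C δ a₂ → IsInnerPost C δ b₁ → IsInnerPost C δ b₂ →
      Z (annulusDomain C) δ a₁ b₁ * Z (annulusDomain C) δ a₂ b₂ ≤
        ENNReal.ofReal θ * (Z (annulusDomain C) δ a₁ a₂ * Z (annulusDomain C) δ b₁ b₂)

end

/-- **`AnnulusPairingGap` is FALSE as typed (coarse-mesh junk).**  For every `C > 1` take the mesh
`δ = max (C/√2) ((1+C)/2)`: then `1 < δ < C ≤ min (√2 δ) (2δ)`, so the lattice annulus
`{x : 1 < δ‖x‖ < C}` is exactly `{±e₁, ±e₂}` — four pairwise non-adjacent sites, an EDGELESS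
discrete domain (all four are kept by the largest-component convention, the components being tied
singletons).  Each of them is simultaneously an outer post (`‖δ·2e₁‖ = 2δ ≥ C`) and an inner post
(`‖δ·0‖ ≤ 1`), so `a₁ = b₁ = e₁`, `a₂ = b₂ = -e₁` is admissible: `Z(a₁,b₁) = Z(e₁,e₁) ≥ 1` (the
trivial walk) while `Z(a₁,a₂) = Z(e₁,-e₁) = 0` (no walk at all), and the inequality reads
`1 ≤ θ · 0`.  Repair: quantify `δ ≤ δ₀(C)` (thick LATTICE annulus), which also forces
`{a₁,a₂} ∩ {b₁,b₂} = ∅`; the repaired statement is untouched by this witness. [folklore] -/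
theorem not_annulusPairingGap : ¬ AnnulusPairingGap := by
  rintro ⟨C, θ, hC, -, H⟩
  -- the coarse mesh
  set δ : ℝ := max (C / Real.sqrt 2) ((1 + C) / 2) with hδdef
  have hs2 : (0 : ℝ) < Real.sqrt 2 := by positivity
  have hs2' : Real.sqrt 2 * Real.sqrt 2 = 2 := Real.mul_self_sqrt (by norm_num)
  have hδ1 : 1 < δ := lt_of_lt_of_le (by linarith) (le_max_right _ _)
  have hδ0 : 0 < δ := one_pos.trans hδ1
  have hδC : δ < C := by
    rw [hδdef, max_lt_iff]
    refine ⟨?_, by linarith⟩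
    rw [div_lt_iff₀ hs2]
    have : (1 : ℝ) < Real.sqrt 2 := by
      rw [show (1 : ℝ) = Real.sqrt 1 by simp]
      exact Real.sqrt_lt_sqrt (by norm_num) (by norm_num)
    nlinarith
  have h2δ : C ≤ 2 * δ := by
    have : (1 + C) / 2 ≤ δ := le_max_right _ _
    linarith
  have hsδ : C ^ 2 ≤ 2 * δ ^ 2 := by
    have h1 : C / Real.sqrt 2 ≤ δ := le_max_left _ _
    rw [div_le_iff₀ hs2] at h1
    have h0 : 0 ≤ C := by linarith
    nlinarith
  -- norms of mesh points
  have norm_mesh : ∀ x : Site 2, ‖meshPoint δ x‖ ^ 2 = δ ^ 2 * ((x 0 : ℝ) ^ 2 + (x 1 : ℝ) ^ 2) := by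
    intro x
    rw [Complex.sq_norm, Complex.normSq_apply, meshPoint_re, meshPoint_im]; ring
  set Ω : Set ℂ := annulusDomain C with hΩ
  have mem_vert : ∀ {x : Site 2}, x ∈ meshVertices Ω δ ↔ 1 < ‖meshPoint δ x‖ ∧ ‖meshPoint δ x‖ < C :=
    fun {x} => Iff.rfl
  -- every mesh vertex is a unit site
  have unit_of_mem : ∀ {x : Site 2}, x ∈ meshVertices Ω δ → (x 0) ^ 2 + (x 1) ^ 2 = 1 := by
    intro x hx
    obtain ⟨h1, h2⟩ := mem_vert.1 hx
    have hn := norm_mesh x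
    have hpos : 0 ≤ ‖meshPoint δ x‖ := norm_nonneg _
    have hlt2 : ((x 0 : ℝ)) ^ 2 + (x 1 : ℝ) ^ 2 < 2 := by
      by_contra hge
      have hge' : 2 ≤ ((x 0 : ℝ)) ^ 2 + (x 1 : ℝ) ^ 2 := not_lt.1 hge
      have : C ^ 2 ≤ ‖meshPoint δ x‖ ^ 2 := by rw [hn]; nlinarith
      nlinarith
    have hgt0 : 0 < ((x 0 : ℝ)) ^ 2 + (x 1 : ℝ) ^ 2 := by
      by_contra hle
      have hle' : ((x 0 : ℝ)) ^ 2 + (x 1 : ℝ) ^ 2 ≤ 0 := not_lt.1 hle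
      have : ‖meshPoint δ x‖ ^ 2 ≤ 0 := by rw [hn]; nlinarith
      nlinarith
    have hlt2' : (x 0) ^ 2 + (x 1) ^ 2 < 2 := by exact_mod_cast hlt2
    have hgt0' : 0 < (x 0) ^ 2 + (x 1) ^ 2 := by exact_mod_cast hgt0
    omega
  -- two unit sites are never lattice neighbours (parity: `2a + 1 ≠ 0`)
  have key : ∀ {a c : ℤ}, a ^ 2 + c ^ 2 = 1 → (a + 1) ^ 2 + c ^ 2 = 1 → False := by
    intro a c h1 h2
    have : 2 * a + 1 = 0 := by linear_combination h2 - h1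
    omega
  have not_adj_units : ∀ {x y : Site 2}, (x 0) ^ 2 + (x 1) ^ 2 = 1 → (y 0) ^ 2 + (y 1) ^ 2 = 1 →
      ¬ (zdGraph 2).Adj x y := by
    intro x y hx hy hadj
    obtain ⟨i, h | h⟩ := (zdGraph_adj_iff x y).1 hadj
    · have h0 := congrFun h 0
      have h1 := congrFun h 1
      fin_cases i
      · simp at h0 h1
        rw [h0, h1] at hy
        exact key hx hy
      · simp at h0 h1
        rw [h0, h1] at hy
        exact key (a := x 1) (c := x 0) (by linarith) (by linarith)
    · have h0 := congrFun h 0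
      have h1 := congrFun h 1
      fin_cases i
      · simp at h0 h1
        rw [h0, h1] at hx
        exact key hy hx
      · simp at h0 h1
        rw [h0, h1] at hx
        exact key (a := y 1) (c := y 0) (by linarith) (by linarith)
  -- hence the mesh vertex graph is edgeless and reachability is equality
  have eq_of_reachable : ∀ {a b : meshVertices Ω δ}, (meshVertexGraph Ω δ).Reachable a b → a = b := by
    intro a b hab
    obtain ⟨p⟩ := hab
    by_cases hlen : p.length = 0
    · exact p.eq_of_length_eq_zero hlen
    · exfalso
      have hadj := p.adj_getVert_succ (i := 0) (Nat.pos_of_ne_zero hlen)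
      rw [SimpleGraph.Walk.getVert_zero] at hadj
      simp only [SimpleGraph.comap_adj, Function.Embedding.subtype_apply] at hadj
      exact not_adj_units (unit_of_mem a.2) (unit_of_mem (p.getVert 1).2)
        (meshGraph_le_zdGraph _ _ hadj)
  -- the bounded annulus has finitely many mesh vertices
  have hΩb : Bornology.IsBounded Ω :=
    (Metric.isBounded_ball (x := (0 : ℂ)) (r := C)).subset fun z hz => by
      simp only [Metric.mem_ball, dist_zero_right]; exact hz.2
  haveI : Finite (meshVertices Ω δ) := (meshVertices_finite hΩb hδ0).to_subtype
  -- every mesh vertex lies in the discrete domain (all components are tied singletons)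
  have mem_dom : ∀ {x : Site 2}, x ∈ meshVertices Ω δ → x ∈ meshDomain Ω δ := by
    intro x hx
    simp only [meshDomain, Set.mem_iUnion, Set.mem_image]
    refine ⟨(meshVertexGraph Ω δ).connectedComponentMk ⟨x, hx⟩, fun C' => ?_, ⟨x, hx⟩, ?_, rfl⟩
    · calc C'.supp.ncard ≤ 1 := by
            rw [Set.ncard_le_one (Set.toFinite _)]
            intro a ha b hb
            rw [SimpleGraph.ConnectedComponent.mem_supp_iff] at ha hb
            exact eq_of_reachable (SimpleGraph.ConnectedComponent.exact (ha.trans hb.symm))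
        _ ≤ ((meshVertexGraph Ω δ).connectedComponentMk ⟨x, hx⟩).supp.ncard := by
            rw [Nat.one_le_iff_ne_zero, Ne, Set.ncard_eq_zero (Set.toFinite _)]
            exact Set.nonempty_iff_ne_empty.1 ⟨⟨x, hx⟩, by
              rw [SimpleGraph.ConnectedComponent.mem_supp_iff]⟩
    · rw [SimpleGraph.ConnectedComponent.mem_supp_iff]
  -- the four posts
  have norm_e : ∀ (m : ℤ), ‖meshPoint δ ![m, 0]‖ = δ * |(m : ℝ)| := by
    intro m
    have : meshPoint δ ![m, 0] = ((δ * m : ℝ) : ℂ) := Complex.ext (by simp) (by simp)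
    rw [this, Complex.norm_real, Real.norm_eq_abs, abs_mul, abs_of_pos hδ0]
  have mem_e : ∀ {m : ℤ}, |(m : ℝ)| = 1 → (![m, 0] : Site 2) ∈ meshVertices Ω δ := by
    intro m hm
    rw [mem_vert, norm_e, hm, mul_one]
    exact ⟨hδ1, hδC⟩
  have mem_e1 : (![1, 0] : Site 2) ∈ meshVertices Ω δ := mem_e (by simp)
  have mem_e1' : (![-1, 0] : Site 2) ∈ meshVertices Ω δ := mem_e (by simp)
  have outer : ∀ {m : ℤ}, |(m : ℝ)| = 1 → IsOuterPost C δ ![m, 0] := by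
    intro m hm
    refine ⟨mem_dom (mem_e hm), ![2 * m, 0], (zdGraph_adj_iff _ _).2 ?_, ?_⟩
    · rcases (abs_eq (by norm_num : (0:ℝ) ≤ 1)).1 hm with h | h
      · have : m = 1 := by exact_mod_cast h
        subst this
        exact ⟨0, Or.inl (by ext i; fin_cases i <;> simp)⟩
      · have : m = -1 := by exact_mod_cast h
        subst this
        exact ⟨0, Or.inr (by ext i; fin_cases i <;> simp)⟩
    · rw [norm_e]; push_cast; rw [abs_mul, hm]; norm_num; linarith
  have inner : ∀ {m : ℤ}, |(m : ℝ)| = 1 → IsInnerPost C δ ![m, 0] := by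
    intro m hm
    refine ⟨mem_dom (mem_e hm), ![0, 0], (zdGraph_adj_iff _ _).2 ?_, ?_⟩
    · rcases (abs_eq (by norm_num : (0:ℝ) ≤ 1)).1 hm with h | h
      · have : m = 1 := by exact_mod_cast h
        subst this
        exact ⟨0, Or.inr (by ext i; fin_cases i <;> simp)⟩
      · have : m = -1 := by exact_mod_cast h
        subst this
        exact ⟨0, Or.inl (by ext i; fin_cases i <;> simp)⟩
    · rw [norm_e]; simp
  -- Z(e₁, -e₁) = 0 : there is no walk at all
  have Z_cross : Z Ω δ ![1, 0] ![-1, 0] = 0 := by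
    have hempty : IsEmpty (DomainSAW Ω δ ![1, 0] ![-1, 0]) := by
      refine ⟨fun γ => ?_⟩
      have hne : (![1, 0] : Site 2) ≠ ![-1, 0] := by
        intro h; have := congrFun h 0; simp at this
      have hlen : γ.walk.length ≠ 0 := fun h0 => hne (γ.walk.eq_of_length_eq_zero h0)
      have hadj := γ.walk.adj_getVert_succ (i := 0) (Nat.pos_of_ne_zero hlen)
      rw [SimpleGraph.Walk.getVert_zero] at hadj
      obtain ⟨hmesh, -, hy⟩ := discreteDomainGraph_adj_iff.1 hadj
      exact not_adj_units (unit_of_mem mem_e1)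
        (unit_of_mem (meshDomain_subset_meshVertices _ _ hy)) (meshGraph_le_zdGraph _ _ hmesh)
    show SAW.weight Ω δ ![1, 0] ![-1, 0] Set.univ = 0
    rw [Set.univ_eq_empty_iff.2 hempty, measure_empty]
  -- Z(u, u) ≥ 1 : the trivial walk
  have Z_self : ∀ u : Site 2, 1 ≤ Z Ω δ u u := by
    intro u
    calc (1 : ENNReal) = SAW.weight Ω δ u u {DomainSAW.nil u} := by
          rw [weight_singleton]; simp
      _ ≤ SAW.weight Ω δ u u Set.univ := measure_mono (Set.subset_univ _)
  -- the admissible degenerate quadruple a₁ = b₁ = e₁, a₂ = b₂ = -e₁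
  have hne : (![1, 0] : Site 2) ≠ ![-1, 0] := by
    intro h; have := congrFun h 0; simp at this
  have key := H δ hδ0 ![1, 0] ![-1, 0] ![1, 0] ![-1, 0] hne hne
    (outer (by simp)) (outer (by simp)) (inner (by simp)) (inner (by simp))
  rw [Z_cross, zero_mul, mul_zero] at key
  have h1 : (1 : ENNReal) ≤ Z Ω δ ![1, 0] ![1, 0] * Z Ω δ ![-1, 0] ![-1, 0] := by
    calc (1 : ENNReal) = 1 * 1 := (one_mul 1).symm
      _ ≤ _ := mul_le_mul' (Z_self _) (Z_self _)
  exact absurd (h1.trans key) (by simp)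


end TargetsSection

end Summit.CriticalPhenomena.SAWScalingLimit.Theorems.TPToTraversalBound.Negative
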